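import Literature.MathematicalPhysics.QuantumFieldTheory.Balaban1983to89.B9Eq352DivFormLetters
import Literature.MathematicalPhysics.QuantumFieldTheory.Balaban1983to89.B9Eq372Operator

/-!
# `Balaban1983to89.B9Eq352GradLetters` — B9 p. 400 (3.52): `V′₁(A)` AS AN OPERATOR IN GRADIENT FORM ON THE CONCRETE
# CARRIER — the zeroth-order letters (`−iad_{D*_UA}`, the remainders `F′_{1,k}`), `V′₁ = V⁰ + Σ_k V¹_k∇_k` as an identity in
# `Module.End ℝ (S → 𝔸)` agreeing pointwise with `B9Eq352ScalarFluct.V1p`, and ALL FOUR letter hypotheses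
# (`hVg`, `hV0`, `hV1`, `hComm`) of the finite-sum commutator device (`B9Ineq386CommSum`, `B9Ineq368CommSum`) as THEOREMS for it

statement-level skeleton of published theorems with citation tags; proofs where landed; nothing here is a claim about the Yang–Mills mass gap

CITATION HEADER (lean-in-tree rule).  T. Bałaban, *Propagators for lattice gauge theories in a background field*, Commun.
Math. Phys. **99** (1985) 389–434 [Balaban1985BackgroundPropagators] (cell paper B9; `paper:balaban1985-cmp99-background-
propagators`, journal page = PDF page + 388): p. 400 [PDF 12] (3.50)–(3.53) (render `…-p012-x2.png` read as image by this
seat; PRINT: (3.50) «(Δ_{U′U}λ)(x) = η⁻²(2dλ(x) − Σ_{b∈st(x)} exp iηad_{A′(b)}R(U_b)λ(b₊))», (3.52) «(V′₁(A)λ)(x) =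
Σ_{b∈st(x)} i[A′(b),(D_Uλ)(b)] + i[(D*_UA)(x),λ(x)] + Σ_{b∈st(x)} F′_{1,k}(iad_{A′(b)})λ(b₊)», «where F′_{1,k}(z) =
η⁻²(e^{ηz} − 1 − ηz) = z²∫₀¹dt(1 − t)e^{ηtz}», (3.53) «Δ_{U′U} = Δ_U − V′₁(A)»; READING (this seat's, NOT print — see
ERRATUM v1.1 below): subtracting (3.50) from (3.23) and expanding the exponential as in (3.51) gives V′₁(A)λ(x) =
Σ_{b∈st(x)} [η⁻¹·iad_{A′(b)} + F′_{1,k}(iad_{A′(b)})]R(U_b)λ(b₊), the form reorganised by `B9Eq352ScalarFluct.V1p_eq_firstOrder`),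
p. 401 [PDF 13] (3.54), p. 396 [PDF 8] (3.37) («|A′| < α₁(Lʲη)⁻¹, |∇^η_UA′| < α₁(Lʲη)⁻² on Ω_j, j = 0,…,k»), p. 405
[PDF 17] (3.72)–(3.73) (PRINT: «The operator V₁ satisfies |(V₁(A)A′)(b)| ≦ O(1)(|A||∇A′| + |∇A||A′| + |A|²|A′|) ≦
O(1)α₁((Lʲη)⁻¹|∇A′| + (Lʲη)⁻²|A′|), b ∈ Ω_j» — a bound for the VECTOR operator V₁(A) acting on bond fields A′, «with the
same conditions on norms as above. The derivatives are, of course, the covariant derivatives defined by U. The constant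
O(1) is an absolute constant depending on d only»; also p. 405: «The operator F_{1,k} is defined similarly to F′_{1,k} by
taking the remainder of the expansion R(U′) = exp ηiad_A = 1 + ηiad_A + ⋯ in the expressions above»; READING (this seat's,
NOT print): the gradient-form sizes «V = V⁰ + V¹∇ with |V⁰| ≦ O(1)α₁(Lʲη)⁻², |V¹| ≦ O(1)α₁(Lʲη)⁻¹» used throughout this
file for the letters of the SCALAR operator V′₁(A) of (3.52) are the shape of the right-hand side of (3.73) transcribed to
V′₁(A) — the hypotheses `hVg`/`hV0`/`hV1` of `B9Ineq385VG`/`B9Ineq386CommSum`/`B9Ineq368CommSum` — and wherever a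
declaration docstring below writes «|V⁰| ≦ O(1)α₁(Lʲη)⁻²», «|V¹| ≦ O(1)α₁(Lʲη)⁻¹» or «V(A) = V⁰ + V¹∇» next to «(3.73)» it
means this reading, not a quotation of p. 405); [4] = T. Bałaban, *Propagators and renormalization
transformations for lattice gauge theories. II*, Commun. Math. Phys. **96** (1984) 223–250 [Balaban1984PropagatorsII],
(2.51)–(2.52) p. 232 (the majorant shape, «A summation preserves it also»); [B8] = T. Bałaban, *Spaces of regular gauge
field configurations on a lattice and gauge fixing conditions*, Commun. Math. Phys. **99** (1985) 75–102
[Balaban1985RegularSpaces], (1.86)–(1.87) p. 91.  Cell `lit-balaban`, seat r06 (B9 fold owner) gen 8, fifth file of the gen;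
SKELETON rows **B9.Eq3.50/3.52/3.54** × **B9.Eq3.73** × **B9.Eq3.85/3.68** (the letters of the device).  Continuation of
the same seat's `B9Eq352ScalarFluct` (g4: `V1p`, `Fp1`, `V1p_eq_firstOrder`, `norm_Fp1_le`, `exp_two_mul_le_two`),
`B9Eq352DivForm` (g8 p260065: `tauF`, `tauB`), `B9Eq352DivFormLetters` (g8 p260922: `conj`, `hasMajorant_conj_of_local`,
`mulLetter`, `gradLetterF/B`, `hasMajorant_comm_forward/backward`) and `B9Ineq386CommSum` (g8 p260368:
`divForm_of_gradForm_sum`, `hasMajorant_C₃_of_comm_sum`), and of pv27's `B9Eq372Operator` (`conjRem_add_right`,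
`conjRem_smul_right`) — all used BY NAME.

WHY.  `B9Eq352DivFormLetters` discharged the commutator hypothesis `hComm k` of the finite-sum device for the concrete
letters; the device's other three letter hypotheses about `V = V′₁(A)` — the gradient-form identity `hVg : V = V⁰ +
Σ_{k∈s} V¹_k∇_k`, the zeroth-order size `hV0 : V⁰ ≺ c_Cα₁(Lʲη)⁻²e^{−δd}` and the coefficient sizes `hV1 k : V¹_k ≺
c_kα₁(Lʲη)⁻¹e^{−δd}` ((3.73)) — were still hypotheses about abstract letters.  This file makes `V′₁(A)` of (3.52) itself
an `ℝ`-linear operator on the concrete carrier `S → 𝔸` of `B9Eq39Adjoint`, written in gradient form with named letters,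
proves that it agrees pointwise with `B9Eq352ScalarFluct.V1p` (the operator DEFINED by (3.53)), and proves the three
remaining hypotheses for its letters under (3.37) read blockwise; so that, for the `V′₁` part of `V′`, every `V`-letter input
of `B9Ineq386CommSum.hasMajorant_GV_of_gradForm_comm_sum` ((3.85)) and `B9Ineq368CommSum.ineq368_op_Ds_of_comm_sum`
((3.68)₃) is a theorem about concrete lattice operators (finite-dimensional `𝔸`, real coordinates `b`).

WHAT THIS FILE PROVES (0 sorry; definitions with bodies + theorems; no `def … : Prop`).
* §1 LINEARITY OF THE REMAINDER in its argument: `conjRem_real_smul_right`, `Fp1_add_right`, `Fp1_smul_right`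
  (`F′_{1}(a)(·)` is `ℝ`-linear; `𝓕(b, ·)` additive/`ℂ`-homogeneous is `B9Eq372Operator.conjRem_add_right/_smul_right` BY NAME).
* §2 THE ZEROTH-ORDER LETTERS of (3.52) as `ℝ`-linear operators on `S → 𝔸`: `divLetter c A` (`λ ↦ −i[(c·divB A)(x),
  λ(x)]`, the `−iad_{D*_UA}` term, `c = η⁻¹`), `remLetterF η μ a` (`λ ↦ F′₁(a(x))(τ_μλ(x))`, forward remainder),
  `remLetterB η μ a` (`λ ↦ F′₁(−τ*_μa(x))(τ*_μλ(x))`, backward remainder); `V0op η A := divLetter η⁻¹ A + Σ_μ (remLetterF η μ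
  (A μ) + remLetterB η μ (A μ))` — the operator `V⁰` of `V′₁`; the letter families over the bonds `k ∈ κ ⊕ κ` (forward `inl μ`,
  backward `inr μ`): `coefLetter A` (`iad_{A_μ}`, `iad_{τ*_μA_μ}` = `B9Eq352DivFormLetters.mulLetter`) and `diffLetter c`
  (`∇_μ = gradLetterF`, `−∇*_μ = −gradLetterB`); **`V1pOp η A := V0op η A + Σ_k coefLetter A k * diffLetter η⁻¹ k`**;
  `V0op_apply`; **`V1pOp_apply`**: `V1pOp η A λ x = B9Eq352ScalarFluct.V1p η A λ x` (`η ≠ 0`; = `V1p_eq_firstOrder`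
  reorganised) — so `V1pOp` IS the operator `V′₁(A)` of (3.53) `Δ_{U′U} = Δ_U − V′₁(A)`; `V1pOp_eq_gradForm` (the shape `hVg`
  before coordinates).
* §3 AFTER REAL COORDINATES (`b : Module.Basis ι ℝ 𝔸`, `conj b` of `B9Eq352DivFormLetters`): `conj_add`, `conj_finset_sum`;
  **`conj_V1pOp_eq_gradForm`**: `conj b (V1pOp η A) = conj b (V0op η A) + Σ_{k∈univ} conj b (coefLetter A k) * conj b
  (diffLetter η⁻¹ k)` — the hypothesis `hVg` of the device with `s = univ : Finset (κ ⊕ κ)`; `conj_V1pOp_eq_divForm` (the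
  divergence form `Σ_k ∇_kV¹_k + (V⁰ + Σ_k[V¹_k, ∇_k])`, `B9Ineq386CommSum.divForm_of_gradForm_sum`).
* §4 SIZES UNDER (3.37) READ BLOCKWISE (`ℓ = g.len y` the scale of the block `y ∋ x`; letters as they occur: `‖A_μ(x)‖,
  ‖τ*_μA_μ(x)‖ ≦ α₁ℓ⁻¹`, `‖η⁻¹D¹*_μA_μ(x)‖, ‖η⁻¹D¹_μA_μ(x)‖, ‖η⁻¹D¹*_μτ*_μA_μ(x)‖ ≦ α₁ℓ⁻²`, `ηα₁ℓ⁻¹ ≦ 1/4`; transports of size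
  `≦ ρ`; the star of `x` in blocks at `d`-distance `≦ d₀`, `d(y,y) ≦ d₀`): `norm_V0op_le` / `norm_V0op_le_printed`
  (pointwise `‖V⁰λ(x)‖ ≦ (2 + 8ρ²α₁)·d·α₁ℓ⁻²·sup_{st(x)}‖λ‖`, `d = card κ`); **`hasMajorant_V0op`** (`conj b V0op ≺
  c_C·α₁·ℓ⁻²·e^{−δd}`, `c_C = (2 + 8ρ²α₁)·d·M₂(Σ_i‖b_i‖)e^{δd₀}` — `hV0`); **`hasMajorant_coefLetter`** (`conj b (coefLetter
  A k) ≺ 2M₂(Σ_i‖b_i‖)e^{δd₀}·α₁·ℓ⁻¹·e^{−δd}` — `hV1 k`); **`hasMajorant_comm_coefLetter_diffLetter`** (`[V¹_k, ∇_k] ≺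
  2ρ²M₂(Σ_i‖b_i‖)e^{δd₀}·α₁·ℓ⁻²·e^{−δd}` for every `k ∈ κ ⊕ κ` — `hComm k`, from `hasMajorant_comm_forward/backward`);
  and the assembled **`hasMajorant_divForm_zeroth_V1pOp`**: `conj b V0op + Σ_k [conj V¹_k, conj ∇_k] ≺ (c_C +
  2d·2ρ²M₂(Σ‖b‖)e^{δd₀})·α₁·ℓ⁻²·e^{−δd}` — the zeroth-order operator `C″₁(A)` of the divergence form of `V′₁(A)` has the
  `(Lʲη)⁻²` majorant ON THE CONCRETE CARRIER (`B9Ineq386CommSum.hasMajorant_C₃_of_comm_sum`).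

HONEST SCOPE / NOT CLAIMED.  (i) `V′₁(A)` only: the full `V′(A) = V′₁(A) − (F′₂*aQ′ + Q′*aF′₂ + F′₂*aF′₂)` of (3.60)
(`B9Eq360Vprime.vPrime_eq`) adds block-local averaging letters to `V⁰`, majorised abstractly by `B9Ineq385VG.ineq383_op`
((3.83)) from the letters `Q`, `F′₂` — they live on p06's `ℤ^d` carrier (`B9Eq356QPrime`), a second seam not written
here.  (ii) The device's NON-`V` hypotheses (Theorem 3.1/3.3 entries `G∇_k`, `G`, `E D*`, `V E`, the letters `Q`, `F₂`,
`C⁻¹`, scale transfers, (2.61)) are untouched bootstrap inputs (p. 402, p. 407).  (iii) Finite-dimensional `𝔸` with a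
real basis `b`; constants `M₂`, `Σ‖b_i‖`, `e^{δd₀}`, `ρ` are bookkeeping invisible in the print's `O(1)` (`ρ = 1` for
unitary `U`).  (iv) (3.37) is consumed in the located blockwise form of `B9Eq352DivForm.norm_zerothPart_le_printed` (the
scale of the block of `x` for every letter at `x`; p. 398 «we can take either Lʲη, or L^{j′}η»); the transported
coefficient `τ*_μA_μ` and its starred difference are hypotheses as they occur (for unitary `U` they are (3.37) at `x − e_μ`,
`B9Eq352DivForm.norm_covDstar_tauB_le`).  (v) `d(y,y) ≦ d₀` converts the block-diagonal letters to the common `e^{δd₀}e^{−δd}`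
shape.  Value = the `V′₁` letters of the (3.68)/(3.85) chains are concrete operators with proved sizes; NOT summit progress.

ERRATUM v1.1 (docstrings only; every declaration, statement and proof byte-identical to v1 p261976; referee
`lit-balaban-ref-1` gen 24, finding F1, row SIGNED).  v1's citation header displayed two passages inside «…» marks labelled
«render … read as image» that are NOT on the page: (a) «V′₁(A) = Σ_{b∈st(x)} η⁻²[ηiad_{A′(b)} + F′_{1,k}(iad_{A′(b)})]R(U_b)
λ(b₊)» — p. 400 prints (3.52) as quoted above (two commutator terms + the `F′_{1,k}` sum); the bracket form was this seat's
(3.50)→(3.51) paraphrase and, read literally, puts an `η⁻²` in front of `F′_{1,k}`, which already carries `η⁻²` (the correct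
reading has `η⁻¹·iad_{A′(b)} + F′_{1,k}(iad_{A′(b)})`; the Lean operator was never affected: `V1pOp_apply` is (3.52)/(3.53)
through `B9Eq352ScalarFluct.V1p_eq_firstOrder`, whose `Fp1` is the printed `F′_{1,k}(z) = η⁻²(e^{ηz} − 1 − ηz)`); (b) «V(A) =
V⁰ + V¹∇, |V⁰| ≦ O(1)α₁(Lʲη)⁻², |V¹| ≦ O(1)α₁(Lʲη)⁻¹» attributed to (3.73) p. 405 — the printed (3.73) bounds the vector
operator `V₁(A)` on bond fields `A′` (quoted above); the `V⁰/V¹` sizes are this seat's gradient-form READING of it, now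
labelled so here and in the docstrings of `V1pOp_eq_gradForm`, `hasMajorant_coefLetter`, `norm_V0op_le_printed`,
`hasMajorant_V0op`, `hasMajorant_divForm_zeroth_V1pOp`; (c) the sentence «…the remainder of the expansion R(U′) = exp ηiad_A
= 1 + ηiad_A + ⋯» is p. 405 (about `F_{1,k}`), not p. 400 — moved.  No content claim of v1 changes.

RELATED IN THE TREE, NOT DUPLICATED (searched 2026-08-21: `lean search 'V1pOp|V0op|remLetter|divLetter'` = ∅; `B9Eq360Vprime`
(p06) has `V′` as an abstract `Module.End` letter `vPrime`; `B9Eq352ScalarFluct.V1p` is a pointwise function, not an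
operator; `B9Eq372Operator` (pv27) makes the VECTOR operators `V₁`, `V₂`, `F₁`, `F₂` of (3.71)/(3.75) `ℂ`-linear maps with
operator-norm bounds — a different object (the vector Laplacian side) in a different norm; imported for `conjRem_add_right`,
`conjRem_smul_right` only; `B9Ineq385VG`/`B9Ineq386RightEntry`/`B9Ineq368PPrimeDs` consume `hVg/hV0/hV1/hComm` as hypotheses).
-/

noncomputable section

namespace Literature.MathematicalPhysics.QuantumFieldTheory.Balaban1983to89.B9Eq352GradLetters

open NormedSpace Complex
open Literature.MathematicalPhysics.QuantumFieldTheory.Balaban1983to89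
open Literature.MathematicalPhysics.QuantumFieldTheory.Balaban1983to89.B6RandomWalk (HasMajorant hasMajorant_mono
  hasMajorant_add)
open Literature.MathematicalPhysics.QuantumFieldTheory.Balaban1983to89.B9Thm34Ext (toB6)
open Literature.MathematicalPhysics.QuantumFieldTheory.Balaban1983to89.Beta.BackgroundVertices (ad norm_ad_le ad_smul_right
  ad_add_right ad_apply)
open Literature.MathematicalPhysics.QuantumFieldTheory.Balaban1983to89.B9Eq39Adjoint
open Literature.MathematicalPhysics.QuantumFieldTheory.Balaban1983to89.B9Eq370Expansion (conjRem norm_R_le)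
open Literature.MathematicalPhysics.QuantumFieldTheory.Balaban1983to89.B9Eq372Operator (conjRem_add_right
  conjRem_smul_right)
open Literature.MathematicalPhysics.QuantumFieldTheory.Balaban1983to89.B9Eq352ScalarFluct (Fp1 Fp1_eq V1p
  V1p_eq_firstOrder norm_Fp1_le exp_two_mul_le_two)
open Literature.MathematicalPhysics.QuantumFieldTheory.Balaban1983to89.B9Eq352DivForm (tauF tauB tauF_apply tauB_apply)
open Literature.MathematicalPhysics.QuantumFieldTheory.Balaban1983to89.B9Eq352DivFormLetters
open Literature.MathematicalPhysics.QuantumFieldTheory.Balaban1983to89.B9Ineq386CommSum (divForm_of_gradForm_sum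
  hasMajorant_C₃_of_comm_sum)
open Literature.MathematicalPhysics.QuantumFieldTheory.Balaban1983to89.B9Ineq368PPrime (hasMajorant_neg)

/-! ## §1  The remainder `F′₁(a)(·)` is `ℝ`-linear in its argument -/

section Remainder

variable {𝔸 : Type*} [NormedRing 𝔸] [NormedAlgebra ℂ 𝔸]

/-- `𝓕(b, r·X) = r·𝓕(b, X)` for REAL `r` (restriction of scalars of `B9Eq372Operator.conjRem_smul_right`).
[cite: Balaban1985BackgroundPropagators, (3.51) p.400] -/
theorem conjRem_real_smul_right (b : 𝔸) (r : ℝ) (X : 𝔸) : conjRem b (r • X) = r • conjRem b X := by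
  rw [← Complex.coe_smul, conjRem_smul_right, Complex.coe_smul]

/-- `F′₁(a)(X + Y) = F′₁(a)X + F′₁(a)Y` (`B9Eq372Operator.conjRem_add_right` BY NAME). [cite: Balaban1985BackgroundPropagators, (3.51) p.400] -/
theorem Fp1_add_right (η : ℝ) (a X Y : 𝔸) : Fp1 η a (X + Y) = Fp1 η a X + Fp1 η a Y := by
  rw [Fp1_eq, Fp1_eq, Fp1_eq, conjRem_add_right, smul_add]

/-- `F′₁(a)(r·X) = r·F′₁(a)X` for real `r`. [cite: Balaban1985BackgroundPropagators, (3.51) p.400] -/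
theorem Fp1_smul_right (η : ℝ) (a : 𝔸) (r : ℝ) (X : 𝔸) : Fp1 η a (r • X) = r • Fp1 η a X := by
  rw [Fp1_eq, Fp1_eq, conjRem_real_smul_right, smul_comm]

end Remainder

/-! ## §2  The zeroth-order letters of (3.52) and `V′₁(A)` as an operator in gradient form -/

section Letters

variable {𝔸 : Type*} [NormedRing 𝔸] [NormedAlgebra ℂ 𝔸] {S : Type} {κ : Type}
variable (T : κ → Equiv.Perm S) (U : κ → S → 𝔸ˣ)

/-- **The divergence-commutator letter `−iad_{(c·divB A)(x)}`** (the term `−i[(D*_UA)(x), λ(x)]` of (3.52) regrouped,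
`D*_UA = η⁻¹divB A` (3.8); sign as the kernel proves it, `B9Eq352ScalarFluct` READING NOTE): block-local, `ℝ`-linear in `λ`.
[cite: Balaban1985BackgroundPropagators, (3.52) p.400 + (3.8) p.392] -/
def divLetter [Fintype κ] (c : ℂ) (A : κ → S → 𝔸) : Module.End ℝ (S → 𝔸) where
  toFun lam := fun x => -((I : ℂ) • ad (c • divB T U A x) (lam x))
  map_add' lam lam' := by
    funext x
    simp only [Pi.add_apply, ad_add_right, smul_add, neg_add]
  map_smul' r lam := by
    funext x
    simp only [Pi.smul_apply, RingHom.id_apply]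
    rw [ad_smul_right, smul_comm, smul_neg]

/-- **The forward remainder letter `F′_{1}(iad_{A′(b)})R(U_b)λ(b₊)`** of (3.51)–(3.52) on the forward bond `b = (x, x+e_μ)`:
`λ ↦ (x ↦ F′₁(a(x))(τ_μλ(x)))`, `F′₁ = B9Eq352ScalarFluct.Fp1`, `ℝ`-linear in `λ`.
[cite: Balaban1985BackgroundPropagators, (3.51)–(3.52) p.400] -/
def remLetterF (η : ℝ) (μ : κ) (a : S → 𝔸) : Module.End ℝ (S → 𝔸) where
  toFun lam := fun x => Fp1 η (a x) (tauF T U μ lam x)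
  map_add' lam lam' := by
    funext x
    simp only [tauF_apply, Pi.add_apply, R_add, Fp1_add_right]
  map_smul' r lam := by
    funext x
    simp only [tauF_apply, Pi.smul_apply, RingHom.id_apply, R_smul, Fp1_smul_right]

/-- **The backward remainder letter** on the bond `b = (x, x−e_μ)`: `λ ↦ (x ↦ F′₁(−τ*_μa(x))(τ*_μλ(x)))` (`A′(b) = −a′₀`,
`a′₀ = R(U_μ(y))⁻¹A_μ(y) = τ*_μA_μ(x)`, `y = x − e_μ`). [cite: Balaban1985BackgroundPropagators, (3.51)–(3.52) p.400] -/
def remLetterB (η : ℝ) (μ : κ) (a : S → 𝔸) : Module.End ℝ (S → 𝔸) where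
  toFun lam := fun x => Fp1 η (-(tauB T U μ a x)) (tauB T U μ lam x)
  map_add' lam lam' := by
    funext x
    simp only [tauB_apply, Pi.add_apply, R_add, Fp1_add_right]
  map_smul' r lam := by
    funext x
    simp only [tauB_apply, Pi.smul_apply, RingHom.id_apply, R_smul, Fp1_smul_right]

/-- **`V⁰`, the zeroth-order operator of `V′₁(A)`** ((3.52) minus its first-order gradient terms): `V⁰ = −iad_{η⁻¹divB A} +
Σ_μ (F′-remainder forward + backward)`. [cite: Balaban1985BackgroundPropagators, (3.52) p.400 + (3.73) p.405] -/
def V0op [Fintype κ] (η : ℝ) (A : κ → S → 𝔸) : Module.End ℝ (S → 𝔸) :=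
  divLetter T U ((η : ℂ)⁻¹) A + ∑ μ, (remLetterF T U η μ (A μ) + remLetterB T U η μ (A μ))

/-- **The coefficient letters `V¹_k = iad_{A′(b)}`** over the bonds `k` of the star (`inl μ`: forward bond, coefficient
`A_μ`; `inr μ`: backward bond, transported coefficient `τ*_μA_μ`). [cite: Balaban1985BackgroundPropagators, (3.52) p.400 + (3.73) p.405] -/
def coefLetter (A : κ → S → 𝔸) : κ ⊕ κ → Module.End ℝ (S → 𝔸)
  | Sum.inl μ => mulLetter (A μ)
  | Sum.inr μ => mulLetter (tauB T U μ (A μ))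

/-- **The difference letters `∇_k`** over the bonds of the star (`inl μ`: `η⁻¹D¹_μ`; `inr μ`: `−η⁻¹D¹*_μ`, the covariant
difference along the backward bond). [cite: Balaban1985BackgroundPropagators, (3.3) p.390 + (3.8) p.392 + (3.52) p.400] -/
def diffLetter (c : ℂ) : κ ⊕ κ → Module.End ℝ (S → 𝔸)
  | Sum.inl μ => gradLetterF T U c μ
  | Sum.inr μ => -gradLetterB T U c μ

/-- **`V′₁(A)` AS AN OPERATOR IN GRADIENT FORM**: `V′₁ = V⁰ + Σ_{k ∈ κ ⊕ κ} V¹_k ∇_k` (the gradient-form reading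
`V = V⁰ + V¹∇` of (3.73) — see the module header — for the operator of (3.52); a reading, not a quotation).
[cite: Balaban1985BackgroundPropagators, (3.52) p.400 + (3.73) p.405] -/
def V1pOp [Fintype κ] (η : ℝ) (A : κ → S → 𝔸) : Module.End ℝ (S → 𝔸) :=
  V0op T U η A + ∑ k, coefLetter T U A k * diffLetter T U ((η : ℂ)⁻¹) k

/-- Unfolding `divLetter`. [cite: Balaban1985BackgroundPropagators, (3.52) p.400] -/
theorem divLetter_apply [Fintype κ] (c : ℂ) (A : κ → S → 𝔸) (lam : S → 𝔸) (x : S) :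
    divLetter T U c A lam x = -((I : ℂ) • ad (c • divB T U A x) (lam x)) := rfl

/-- Unfolding `remLetterF`. [cite: Balaban1985BackgroundPropagators, (3.52) p.400] -/
theorem remLetterF_apply (η : ℝ) (μ : κ) (a lam : S → 𝔸) (x : S) :
    remLetterF T U η μ a lam x = Fp1 η (a x) (tauF T U μ lam x) := rfl

/-- Unfolding `remLetterB`. [cite: Balaban1985BackgroundPropagators, (3.52) p.400] -/
theorem remLetterB_apply (η : ℝ) (μ : κ) (a lam : S → 𝔸) (x : S) :
    remLetterB T U η μ a lam x = Fp1 η (-(tauB T U μ a x)) (tauB T U μ lam x) := rfl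

/-- `coefLetter` on a forward bond. [cite: Balaban1985BackgroundPropagators, (3.52) p.400] -/
theorem coefLetter_inl (A : κ → S → 𝔸) (μ : κ) : coefLetter T U A (Sum.inl μ) = mulLetter (A μ) := rfl

/-- `coefLetter` on a backward bond. [cite: Balaban1985BackgroundPropagators, (3.52) p.400] -/
theorem coefLetter_inr (A : κ → S → 𝔸) (μ : κ) : coefLetter T U A (Sum.inr μ) = mulLetter (tauB T U μ (A μ)) := rfl

/-- `diffLetter` on a forward bond. [cite: Balaban1985BackgroundPropagators, (3.3) p.390] -/
theorem diffLetter_inl (c : ℂ) (μ : κ) : diffLetter T U c (Sum.inl μ) = gradLetterF T U c μ := rfl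

/-- `diffLetter` on a backward bond. [cite: Balaban1985BackgroundPropagators, (3.8) p.392] -/
theorem diffLetter_inr (c : ℂ) (μ : κ) : diffLetter T U c (Sum.inr μ) = -gradLetterB T U c μ := rfl

/-- **`V⁰λ(x)` written out**: `−i[(η⁻¹divB A)(x), λ(x)] + Σ_μ (F′₁(A_μ(x))(R(U_μ(x))λ(x+e_μ)) + F′₁(−a′₀)(R(U_μ(y))⁻¹λ(y)))` —
the last two lines of `B9Eq352ScalarFluct.V1p_eq_firstOrder`. [cite: Balaban1985BackgroundPropagators, (3.52) p.400] -/
theorem V0op_apply [Fintype κ] (η : ℝ) (A : κ → S → 𝔸) (lam : S → 𝔸) (x : S) :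
    V0op T U η A lam x
      = -((I : ℂ) • ad (((η : ℂ)⁻¹) • divB T U A x) (lam x))
        + ∑ μ, (Fp1 η (A μ x) (R (U μ x) (lam (T μ x)))
          + Fp1 η (-(R (U μ ((T μ).symm x))⁻¹ (A μ ((T μ).symm x)))) (R (U μ ((T μ).symm x))⁻¹ (lam ((T μ).symm x)))) := by
  simp only [V0op, LinearMap.add_apply, LinearMap.sum_apply, Pi.add_apply, Finset.sum_apply, divLetter_apply,
    remLetterF_apply, remLetterB_apply, tauF_apply, tauB_apply]

/-- `V1pOp` unfolds to the gradient form over `univ` (the shape `hVg` of the finite-sum device, before coordinates).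
[cite: Balaban1985BackgroundPropagators, (3.52) p.400 + (3.73) p.405] -/
theorem V1pOp_eq_gradForm [Fintype κ] (η : ℝ) (A : κ → S → 𝔸) :
    V1pOp T U η A = V0op T U η A + ∑ k ∈ Finset.univ, coefLetter T U A k * diffLetter T U ((η : ℂ)⁻¹) k := rfl

omit [NormedAlgebra ℂ 𝔸] in
/-- `[a, −m] = −[a, m]`. [folklore] -/
private theorem ad_neg_right (a m : 𝔸) : ad a (-m) = -ad a m := by
  simp only [ad_apply, mul_neg, neg_mul, neg_sub]
  abel

/-- **`V1pOp` IS `V′₁(A)`**: for `η ≠ 0`, `(V1pOp η A)λ(x) = V′₁(A)λ(x)` with `V′₁` the function `B9Eq352ScalarFluct.V1p`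
DEFINED by (3.53) `Δ_{U′U} = Δ_U − V′₁(A)` — `V1p_eq_firstOrder` reorganised into `V⁰ + Σ_k V¹_k∇_k`.
[cite: Balaban1985BackgroundPropagators, (3.50)–(3.53) p.400 + (3.73) p.405] -/
theorem V1pOp_apply [Fintype κ] (η : ℝ) (hη : η ≠ 0) (A : κ → S → 𝔸) (lam : S → 𝔸) (x : S) :
    V1pOp T U η A lam x = V1p T U η A lam x := by
  rw [V1p_eq_firstOrder T U η hη A lam x]
  simp only [V1pOp, LinearMap.add_apply, LinearMap.sum_apply, Pi.add_apply, Finset.sum_apply, Fintype.sum_sum_type,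
    coefLetter_inl, coefLetter_inr, diffLetter_inl, diffLetter_inr, Module.End.mul_apply, LinearMap.neg_apply,
    Pi.neg_apply, mulLetter_apply, gradLetterF_apply, gradLetterB_apply, V0op_apply, tauB_apply, ad_neg_right, smul_neg,
    Finset.sum_neg_distrib, Finset.sum_sub_distrib]
  abel

/-- **`V′₁(A) = V1pOp` as functions** (`η ≠ 0`). [cite: Balaban1985BackgroundPropagators, (3.52)–(3.53) p.400] -/
theorem V1pOp_eq_V1p [Fintype κ] (η : ℝ) (hη : η ≠ 0) (A : κ → S → 𝔸) (lam : S → 𝔸) :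
    (V1pOp T U η A lam : S → 𝔸) = V1p T U η A lam :=
  funext fun x => V1pOp_apply T U η hη A lam x

end Letters

/-! ## §3  After real coordinates: the gradient form `hVg` and the divergence form -/

section ConjAdd

variable {E : Type*} [NormedAddCommGroup E] [NormedSpace ℝ E] {ι : Type} [Fintype ι] {S : Type}
variable (b : Module.Basis ι ℝ E)

/-- `conj` is additive ([4] p. 232 «A summation preserves it also»). [cite: Balaban1984PropagatorsII, (2.52) p.232] -/
theorem conj_add (T₁ T₂ : Module.End ℝ (S → E)) : conj b (T₁ + T₂) = conj b T₁ + conj b T₂ := by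
  simp only [conj, map_add]

/-- `conj` of a finite sum. [cite: Balaban1984PropagatorsII, (2.52) p.232] -/
theorem conj_finset_sum {K : Type} (s : Finset K) (f : K → Module.End ℝ (S → E)) :
    conj b (∑ k ∈ s, f k) = ∑ k ∈ s, conj b (f k) := by
  simp only [conj, map_sum]

end ConjAdd

section Coordinates

variable {𝔸 : Type*} [NormedRing 𝔸] [NormedAlgebra ℂ 𝔸] {ι : Type} [Fintype ι]
variable (b : Module.Basis ι ℝ 𝔸) {S : Type} {κ : Type} [Fintype κ]
variable (T : κ → Equiv.Perm S) (U : κ → S → 𝔸ˣ)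

/-- **`hVg` FOR THE CONCRETE `V′₁(A)`**: `conj b (V1pOp η A) = conj b V⁰ + Σ_{k∈univ} conj b (V¹_k) * conj b (∇_k)` — the
gradient-form hypothesis of `B9Ineq386CommSum.hasMajorant_GV_of_gradForm_comm_sum` / `B9Ineq368CommSum.ineq368_op_Ds_of_comm_sum`
with `V := conj b (V1pOp η A)`, `V0 := conj b (V0op η A)`, `V1 k := conj b (coefLetter A k)`, `D k := conj b (diffLetter η⁻¹
k)`, `s := univ`. [cite: Balaban1985BackgroundPropagators, (3.52) p.400 + (3.73) p.405; Balaban1984PropagatorsII, (2.52) p.232] -/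
theorem conj_V1pOp_eq_gradForm (η : ℝ) (A : κ → S → 𝔸) :
    conj b (V1pOp T U η A)
      = conj b (V0op T U η A)
        + ∑ k ∈ Finset.univ, conj b (coefLetter T U A k) * conj b (diffLetter T U ((η : ℂ)⁻¹) k) := by
  rw [V1pOp_eq_gradForm, conj_add, conj_finset_sum]
  simp only [B9Eq352DivFormLetters.conj_mul]

/-- **The divergence form after coordinates**: `conj b (V1pOp η A) = Σ_k ∇_kV¹_k + (V⁰ + Σ_k (V¹_k∇_k − ∇_kV¹_k))`
(`B9Ineq386CommSum.divForm_of_gradForm_sum`). [cite: Balaban1985BackgroundPropagators, (3.52) p.400 + (3.73) p.405; Balaban1985RegularSpaces, (1.87) p.91] -/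
theorem conj_V1pOp_eq_divForm (η : ℝ) (A : κ → S → 𝔸) :
    conj b (V1pOp T U η A)
      = ∑ k ∈ Finset.univ, conj b (diffLetter T U ((η : ℂ)⁻¹) k) * conj b (coefLetter T U A k)
        + (conj b (V0op T U η A)
          + ∑ k ∈ Finset.univ, (conj b (coefLetter T U A k) * conj b (diffLetter T U ((η : ℂ)⁻¹) k)
            - conj b (diffLetter T U ((η : ℂ)⁻¹) k) * conj b (coefLetter T U A k))) :=
  divForm_of_gradForm_sum Finset.univ (conj_V1pOp_eq_gradForm b T U η A)

end Coordinates

/-! ## §4  Sizes under (3.37): `hV0`, `hV1`, `hComm` for the concrete letters -/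

section CoefSizes

variable {𝔸 : Type*} [NormedRing 𝔸] [NormedAlgebra ℂ 𝔸] {ι : Type} [Fintype ι]
variable (b : Module.Basis ι ℝ 𝔸) {S : Type} {κ : Type}
variable (T : κ → Equiv.Perm S) (U : κ → S → 𝔸ˣ)
variable {g : B9.Geometry} [Fintype g.Site] {Rr : ℝ} {H : Prop}

/-- **`hV1 k` FOR THE CONCRETE COEFFICIENT LETTERS**: under (3.37) read blockwise for the coefficients as they occur
(`‖A_μ(x)‖, ‖τ*_μA_μ(x)‖ ≦ α₁ℓ⁻¹`, `ℓ = g.len y`, `y ∋ x`) and `d(y,y) ≦ d₀`: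
`conj b (coefLetter A k) ≺ 2M₂(Σ_i‖b_i‖)e^{δd₀}·α₁·ℓ⁻¹·e^{−δd(y,y′)}` for every bond `k` — the size `|V¹| ≦ O(1)α₁(Lʲη)⁻¹`
of the gradient-form reading of (3.73) (module header; a reading, not a quotation) for the coefficients of (3.52), in the
hypothesis shape `hV1 k` of the finite-sum device.
[cite: Balaban1985BackgroundPropagators, (3.73) p.405 + (3.52) p.400 + (3.37) p.396; Balaban1984PropagatorsII, (2.51) p.232] -/
theorem hasMajorant_coefLetter (blk : S → g.Site) (A : κ → S → 𝔸) (d₀ δ M₂ α₁ : ℝ)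
    (hα₁ : 0 ≤ α₁) (hδ : 0 ≤ δ) (hM₂ : 0 ≤ M₂) (hrepr : ∀ (v : 𝔸) (i : ι), |b.repr v i| ≤ M₂ * ‖v‖)
    (hlen : ∀ y : g.Site, 0 < g.len y)
    (hA : ∀ μ x, ‖A μ x‖ ≤ α₁ * (g.len (blk x))⁻¹ ∧ ‖tauB T U μ (A μ) x‖ ≤ α₁ * (g.len (blk x))⁻¹)
    (hd₀0 : ∀ y : g.Site, g.dist y y ≤ d₀) (k : κ ⊕ κ) :
    HasMajorant (g := toB6 g Rr H) (fun p : S × ι => blk p.1) (conj b (coefLetter T U A k))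
      (fun y y' => (2 * M₂ * (∑ i, ‖b i‖) * Real.exp (δ * d₀)) * α₁ * (g.len y)⁻¹ * Real.exp (-(δ * g.dist y y'))) := by
  -- a pointwise coefficient letter `iad_{a}` with `‖a(x)‖ ≦ α₁ℓ⁻¹`
  have key : ∀ a : S → 𝔸, (∀ x, ‖a x‖ ≤ α₁ * (g.len (blk x))⁻¹) →
      HasMajorant (g := toB6 g Rr H) (fun p : S × ι => blk p.1) (conj b (mulLetter a))
        (fun y y' => (2 * M₂ * (∑ i, ‖b i‖) * Real.exp (δ * d₀)) * α₁ * (g.len y)⁻¹ *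
          Real.exp (-(δ * g.dist y y'))) := by
    intro a ha
    have hc0 : ∀ y : g.Site, 0 ≤ 2 * α₁ * (g.len y)⁻¹ := fun y => by have := hlen y; positivity
    refine hasMajorant_mono (g := toB6 g Rr H) _
      (hasMajorant_conj_of_local (Rr := Rr) (H := H) b blk (fun x x' => x' = x) (fun y => 2 * α₁ * (g.len y)⁻¹) d₀ δ M₂
        hc0 hδ hM₂ hrepr (fun x x' hx' => by rw [hx']; exact hd₀0 _) (mulLetter a) ?_) fun y y' => le_of_eq ?_
    · intro f x B hB
      have hB' : ‖f x‖ ≤ B := hB x rfl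
      rw [mulLetter_apply, norm_smul, Complex.norm_I, one_mul]
      calc ‖ad (a x) (f x)‖ ≤ 2 * ‖a x‖ * ‖f x‖ := norm_ad_le _ _
        _ ≤ 2 * (α₁ * (g.len (blk x))⁻¹) * B := by
            have h0 : 0 ≤ α₁ * (g.len (blk x))⁻¹ := mul_nonneg hα₁ (inv_nonneg.mpr (hlen _).le)
            have := ha x
            gcongr
        _ = 2 * α₁ * (g.len (blk x))⁻¹ * B := by ring
    · ring
  cases k with
  | inl μ => rw [coefLetter_inl]; exact key (A μ) fun x => (hA μ x).1
  | inr μ => rw [coefLetter_inr]; exact key (tauB T U μ (A μ)) fun x => (hA μ x).2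

/-- **`hComm k` FOR THE CONCRETE LETTER FAMILIES** (both orientations at once): under (3.37) read blockwise for the
coefficient differences as they occur (`‖η⁻¹D¹_μA_μ(x)‖, ‖η⁻¹D¹*_μτ*_μA_μ(x)‖ ≦ α₁ℓ⁻²`), transports of size `≦ ρ` and the star
of every `x` in blocks at `d`-distance `≦ d₀`:
`conj b (V¹_k) * conj b (∇_k) − conj b (∇_k) * conj b (V¹_k) ≺ 2ρ²M₂(Σ_i‖b_i‖)e^{δd₀}·α₁·ℓ⁻²·e^{−δd}` for every `k ∈ κ ⊕ κ`
(`B9Eq352DivFormLetters.hasMajorant_comm_forward` on `inl μ`; `hasMajorant_comm_backward` with the sign of `−∇*_μ` on `inr μ`).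
[cite: Balaban1985BackgroundPropagators, (3.37) p.396 + (3.52) p.400 + (3.73) p.405; Balaban1985RegularSpaces, (1.87) p.91; Balaban1984PropagatorsII, (2.51) p.232] -/
theorem hasMajorant_comm_coefLetter_diffLetter (blk : S → g.Site) (η : ℝ) (A : κ → S → 𝔸) (ρ d₀ δ M₂ α₁ : ℝ)
    (hα₁ : 0 ≤ α₁) (hδ : 0 ≤ δ) (hM₂ : 0 ≤ M₂) (hrepr : ∀ (v : 𝔸) (i : ι), |b.repr v i| ≤ M₂ * ‖v‖)
    (h337F : ∀ μ x, ‖((η : ℂ)⁻¹) • covD T U μ (A μ) x‖ ≤ α₁ * (g.len (blk x) ^ 2)⁻¹)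
    (h337B : ∀ μ x, ‖((η : ℂ)⁻¹) • covDstar T U μ (tauB T U μ (A μ)) x‖ ≤ α₁ * (g.len (blk x) ^ 2)⁻¹)
    (hρ : ∀ μ x, ‖((U μ x : 𝔸ˣ) : 𝔸)‖ ≤ ρ ∧ ‖(((U μ x)⁻¹ : 𝔸ˣ) : 𝔸)‖ ≤ ρ)
    (hd₀ : ∀ μ x, g.dist (blk x) (blk (T μ x)) ≤ d₀ ∧ g.dist (blk x) (blk ((T μ).symm x)) ≤ d₀) (k : κ ⊕ κ) :
    HasMajorant (g := toB6 g Rr H) (fun p : S × ι => blk p.1)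
      (conj b (coefLetter T U A k) * conj b (diffLetter T U ((η : ℂ)⁻¹) k)
        - conj b (diffLetter T U ((η : ℂ)⁻¹) k) * conj b (coefLetter T U A k))
      (fun y y' => (2 * ρ ^ 2 * M₂ * (∑ i, ‖b i‖) * Real.exp (δ * d₀)) * α₁ * (g.len y ^ 2)⁻¹ *
        Real.exp (-(δ * g.dist y y'))) := by
  cases k with
  | inl μ =>
      rw [coefLetter_inl, diffLetter_inl]
      exact hasMajorant_comm_forward (Rr := Rr) (H := H) b T U blk η μ A ρ d₀ δ M₂ α₁ hα₁ hδ hM₂ hrepr (h337F μ) (hρ μ)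
        fun x => (hd₀ μ x).1
  | inr μ =>
      rw [coefLetter_inr, diffLetter_inr, conj_neg]
      have hop : conj b (mulLetter (tauB T U μ (A μ))) * -conj b (gradLetterB T U ((η : ℂ)⁻¹) μ)
          - -conj b (gradLetterB T U ((η : ℂ)⁻¹) μ) * conj b (mulLetter (tauB T U μ (A μ)))
          = -(conj b (mulLetter (tauB T U μ (A μ))) * conj b (gradLetterB T U ((η : ℂ)⁻¹) μ)
              - conj b (gradLetterB T U ((η : ℂ)⁻¹) μ) * conj b (mulLetter (tauB T U μ (A μ)))) := by
        ext f p
        simp only [LinearMap.sub_apply, LinearMap.neg_apply, Module.End.mul_apply, map_neg, Pi.sub_apply, Pi.neg_apply]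
        ring
      rw [hop]
      exact hasMajorant_neg (R := Rr) (H := H) _
        (hasMajorant_comm_backward (Rr := Rr) (H := H) b T U blk η μ (tauB T U μ (A μ)) ρ d₀ δ M₂ α₁ hα₁ hδ hM₂ hrepr
          (h337B μ) (fun x => ⟨(hρ μ ((T μ).symm x)).2, by rw [inv_inv]; exact (hρ μ ((T μ).symm x)).1⟩)
          fun x => (hd₀ μ x).2)

end CoefSizes

section Sizes

variable {𝔸 : Type*} [NormedRing 𝔸] [NormedAlgebra ℂ 𝔸] [CompleteSpace 𝔸] {ι : Type} [Fintype ι]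
variable (b : Module.Basis ι ℝ 𝔸) {S : Type} {κ : Type} [Fintype κ]
variable (T : κ → Equiv.Perm S) (U : κ → S → 𝔸ˣ)
variable {g : B9.Geometry} [Fintype g.Site] {Rr : ℝ} {H : Prop}

omit [NormedAlgebra ℂ 𝔸] [CompleteSpace 𝔸] [Fintype ι] [Fintype κ] T U in
/-- Transport size: `‖R(V)Z‖ ≦ ρ²‖Z‖` for `‖V‖, ‖V⁻¹‖ ≦ ρ` (`B9Eq370Expansion.norm_R_le`). [folklore] -/
private theorem norm_R_le_sq₃ [NormedAlgebra ℂ 𝔸] (V : 𝔸ˣ) {ρ : ℝ} (h1 : ‖(V : 𝔸)‖ ≤ ρ)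
    (h2 : ‖((V⁻¹ : 𝔸ˣ) : 𝔸)‖ ≤ ρ) (Z : 𝔸) : ‖R V Z‖ ≤ ρ ^ 2 * ‖Z‖ := by
  have hρ : 0 ≤ ρ := (norm_nonneg _).trans h1
  calc ‖R V Z‖ ≤ ‖(V : 𝔸)‖ * ‖Z‖ * ‖((V⁻¹ : 𝔸ˣ) : 𝔸)‖ := norm_R_le V Z
    _ ≤ ρ * ‖Z‖ * ρ :=
        mul_le_mul (mul_le_mul_of_nonneg_right h1 (norm_nonneg Z)) h2 (norm_nonneg _) (mul_nonneg hρ (norm_nonneg Z))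
    _ = ρ ^ 2 * ‖Z‖ := by ring

omit [NormedAlgebra ℂ 𝔸] [CompleteSpace 𝔸] [Fintype ι] [Fintype κ] T U in
/-- Monotonicity of the remainder constant: `‖a‖ ≦ s ⟹ 2‖a‖²e^{2η‖a‖} ≦ 2s²e^{2ηs}` (`η ≧ 0`). [folklore] -/
private theorem rem_const_mono' {η s : ℝ} (hη : 0 ≤ η) {a : 𝔸} (ha : ‖a‖ ≤ s) :
    2 * ‖a‖ ^ 2 * Real.exp (2 * (η * ‖a‖)) ≤ 2 * s ^ 2 * Real.exp (2 * (η * s)) := by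
  have h0 : 0 ≤ ‖a‖ := norm_nonneg a
  have h1 : ‖a‖ ^ 2 ≤ s ^ 2 := pow_le_pow_left₀ h0 ha 2
  have h2 : Real.exp (2 * (η * ‖a‖)) ≤ Real.exp (2 * (η * s)) := Real.exp_le_exp.mpr (by nlinarith)
  have h3 : 0 ≤ Real.exp (2 * (η * ‖a‖)) := (Real.exp_pos _).le
  gcongr

omit [Fintype ι] in
/-- **Pointwise size of `V⁰λ(x)` from local hypotheses at the star of `x`** (letters as they occur): coefficients `‖A_μ(x)‖,
‖τ*_μA_μ(x)‖ ≦ a`, `‖(η⁻¹divB A)(x)‖ ≦ g′`, transports of size `≦ ρ`, `‖λ‖ ≦ B` on `st(x)`: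
`‖V⁰λ(x)‖ ≦ (2g′ + 4d·ρ²·a²e^{2ηa})·B`, `d = card κ`. [cite: Balaban1985BackgroundPropagators, (3.52) p.400 + (3.54) p.401] -/
theorem norm_V0op_le {η : ℝ} (hη : 0 < η) (A : κ → S → 𝔸) (lam : S → 𝔸) (x : S) {a g' ρ B : ℝ}
    (hA : ∀ μ, ‖A μ x‖ ≤ a ∧ ‖tauB T U μ (A μ) x‖ ≤ a)
    (hdiv : ‖((η : ℂ)⁻¹) • divB T U A x‖ ≤ g')
    (hρ : ∀ μ, (‖((U μ x : 𝔸ˣ) : 𝔸)‖ ≤ ρ ∧ ‖(((U μ x)⁻¹ : 𝔸ˣ) : 𝔸)‖ ≤ ρ)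
      ∧ (‖((U μ ((T μ).symm x) : 𝔸ˣ) : 𝔸)‖ ≤ ρ ∧ ‖(((U μ ((T μ).symm x))⁻¹ : 𝔸ˣ) : 𝔸)‖ ≤ ρ))
    (hl : ‖lam x‖ ≤ B) (hB : ∀ μ, ‖lam (T μ x)‖ ≤ B ∧ ‖lam ((T μ).symm x)‖ ≤ B) :
    ‖V0op T U η A lam x‖ ≤ (2 * g' + 4 * Fintype.card κ * ρ ^ 2 * (a ^ 2 * Real.exp (2 * (η * a)))) * B := by
  have hB0 : 0 ≤ B := (norm_nonneg _).trans hl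
  have hg0 : 0 ≤ g' := (norm_nonneg _).trans hdiv
  -- the divergence commutator
  have hS1 : ‖-((I : ℂ) • ad (((η : ℂ)⁻¹) • divB T U A x) (lam x))‖ ≤ 2 * g' * B := by
    rw [norm_neg, norm_smul, Complex.norm_I, one_mul]
    refine (norm_ad_le _ _).trans ?_
    gcongr
  -- the remainders, per direction
  have hE : 0 ≤ 2 * a ^ 2 * Real.exp (2 * (η * a)) := by positivity
  have h3 : ∀ μ, ‖Fp1 η (A μ x) (R (U μ x) (lam (T μ x)))
      + Fp1 η (-(R (U μ ((T μ).symm x))⁻¹ (A μ ((T μ).symm x)))) (R (U μ ((T μ).symm x))⁻¹ (lam ((T μ).symm x)))‖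
      ≤ 2 * a ^ 2 * Real.exp (2 * (η * a)) * (ρ ^ 2 * B) + 2 * a ^ 2 * Real.exp (2 * (η * a)) * (ρ ^ 2 * B) := by
    intro μ
    have hY1 : ‖R (U μ x) (lam (T μ x))‖ ≤ ρ ^ 2 * B :=
      (norm_R_le_sq₃ (U μ x) (hρ μ).1.1 (hρ μ).1.2 _).trans
        (mul_le_mul_of_nonneg_left (hB μ).1 (sq_nonneg _))
    have hY2 : ‖R (U μ ((T μ).symm x))⁻¹ (lam ((T μ).symm x))‖ ≤ ρ ^ 2 * B := by
      refine (norm_R_le_sq₃ (U μ ((T μ).symm x))⁻¹ (hρ μ).2.2 ?_ _).trans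
        (mul_le_mul_of_nonneg_left (hB μ).2 (sq_nonneg _))
      rw [inv_inv]; exact (hρ μ).2.1
    refine (norm_add_le _ _).trans (add_le_add ?_ ?_)
    · refine (norm_Fp1_le hη _ _).trans ?_
      calc 2 * ‖A μ x‖ ^ 2 * Real.exp (2 * (η * ‖A μ x‖)) * ‖R (U μ x) (lam (T μ x))‖
          ≤ 2 * a ^ 2 * Real.exp (2 * (η * a)) * ‖R (U μ x) (lam (T μ x))‖ :=
            mul_le_mul_of_nonneg_right (rem_const_mono' hη.le (hA μ).1) (norm_nonneg _)
        _ ≤ 2 * a ^ 2 * Real.exp (2 * (η * a)) * (ρ ^ 2 * B) := mul_le_mul_of_nonneg_left hY1 hE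
    · refine (norm_Fp1_le hη _ _).trans ?_
      have ha' : ‖-(R (U μ ((T μ).symm x))⁻¹ (A μ ((T μ).symm x)))‖ ≤ a := by
        rw [norm_neg]; exact (hA μ).2
      calc 2 * ‖-(R (U μ ((T μ).symm x))⁻¹ (A μ ((T μ).symm x)))‖ ^ 2
            * Real.exp (2 * (η * ‖-(R (U μ ((T μ).symm x))⁻¹ (A μ ((T μ).symm x)))‖))
            * ‖R (U μ ((T μ).symm x))⁻¹ (lam ((T μ).symm x))‖
          ≤ 2 * a ^ 2 * Real.exp (2 * (η * a)) * ‖R (U μ ((T μ).symm x))⁻¹ (lam ((T μ).symm x))‖ :=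
            mul_le_mul_of_nonneg_right (rem_const_mono' hη.le ha') (norm_nonneg _)
        _ ≤ 2 * a ^ 2 * Real.exp (2 * (η * a)) * (ρ ^ 2 * B) := mul_le_mul_of_nonneg_left hY2 hE
  have hS3 : ‖∑ μ, (Fp1 η (A μ x) (R (U μ x) (lam (T μ x)))
      + Fp1 η (-(R (U μ ((T μ).symm x))⁻¹ (A μ ((T μ).symm x)))) (R (U μ ((T μ).symm x))⁻¹ (lam ((T μ).symm x))))‖
      ≤ 4 * Fintype.card κ * ρ ^ 2 * (a ^ 2 * Real.exp (2 * (η * a))) * B := by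
    refine (norm_sum_le _ _).trans ?_
    calc ∑ μ, ‖Fp1 η (A μ x) (R (U μ x) (lam (T μ x)))
          + Fp1 η (-(R (U μ ((T μ).symm x))⁻¹ (A μ ((T μ).symm x)))) (R (U μ ((T μ).symm x))⁻¹ (lam ((T μ).symm x)))‖
        ≤ ∑ _μ : κ, (2 * a ^ 2 * Real.exp (2 * (η * a)) * (ρ ^ 2 * B)
            + 2 * a ^ 2 * Real.exp (2 * (η * a)) * (ρ ^ 2 * B)) := Finset.sum_le_sum fun μ _ => h3 μ
      _ = 4 * Fintype.card κ * ρ ^ 2 * (a ^ 2 * Real.exp (2 * (η * a))) * B := by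
          rw [Finset.sum_const, Finset.card_univ, nsmul_eq_mul]; ring
  rw [V0op_apply]
  calc ‖-((I : ℂ) • ad (((η : ℂ)⁻¹) • divB T U A x) (lam x))
        + ∑ μ, (Fp1 η (A μ x) (R (U μ x) (lam (T μ x)))
          + Fp1 η (-(R (U μ ((T μ).symm x))⁻¹ (A μ ((T μ).symm x)))) (R (U μ ((T μ).symm x))⁻¹ (lam ((T μ).symm x))))‖
      ≤ ‖-((I : ℂ) • ad (((η : ℂ)⁻¹) • divB T U A x) (lam x))‖
        + ‖∑ μ, (Fp1 η (A μ x) (R (U μ x) (lam (T μ x)))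
          + Fp1 η (-(R (U μ ((T μ).symm x))⁻¹ (A μ ((T μ).symm x)))) (R (U μ ((T μ).symm x))⁻¹ (lam ((T μ).symm x))))‖ :=
        norm_add_le _ _
    _ ≤ 2 * g' * B + 4 * Fintype.card κ * ρ ^ 2 * (a ^ 2 * Real.exp (2 * (η * a))) * B := add_le_add hS1 hS3
    _ = (2 * g' + 4 * Fintype.card κ * ρ ^ 2 * (a ^ 2 * Real.exp (2 * (η * a)))) * B := by ring

omit [Fintype ι] in
/-- **`V⁰λ(x)` IN THE PRINTED REGIME (3.37)** read at `x` with the scale `s = Lʲη > 0` of its block: `‖A_μ(x)‖, ‖τ*_μA_μ(x)‖ ≦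
α₁s⁻¹`, `‖η⁻¹D¹*_μA_μ(x)‖ ≦ α₁s⁻²` (so `‖η⁻¹divB A(x)‖ ≦ dα₁s⁻²`), `ηα₁s⁻¹ ≦ 1/4` («α₁ sufficiently small»), transports of size
`≦ ρ`, `‖λ‖ ≦ B` on `st(x)`: `‖V⁰λ(x)‖ ≦ (2 + 8ρ²α₁)·d·α₁s⁻²·B` — the size `|V⁰| ≦ O(1)α₁(Lʲη)⁻²` of the gradient-form
reading of (3.73) (module header; a reading, not a quotation) for the operator of (3.52).
[cite: Balaban1985BackgroundPropagators, (3.52) p.400 + (3.54) p.401 + (3.37) p.396 + (3.73) p.405] -/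
theorem norm_V0op_le_printed {η : ℝ} (hη : 0 < η) (A : κ → S → 𝔸) (lam : S → 𝔸) (x : S) {α₁ s ρ B : ℝ}
    (hα : 0 ≤ α₁) (hs : 0 < s) (hsmall : η * (α₁ * s⁻¹) ≤ 1 / 4)
    (hA : ∀ μ, ‖A μ x‖ ≤ α₁ * s⁻¹ ∧ ‖tauB T U μ (A μ) x‖ ≤ α₁ * s⁻¹)
    (h337s : ∀ μ, ‖((η : ℂ)⁻¹) • covDstar T U μ (A μ) x‖ ≤ α₁ * (s ^ 2)⁻¹)
    (hρ : ∀ μ, (‖((U μ x : 𝔸ˣ) : 𝔸)‖ ≤ ρ ∧ ‖(((U μ x)⁻¹ : 𝔸ˣ) : 𝔸)‖ ≤ ρ)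
      ∧ (‖((U μ ((T μ).symm x) : 𝔸ˣ) : 𝔸)‖ ≤ ρ ∧ ‖(((U μ ((T μ).symm x))⁻¹ : 𝔸ˣ) : 𝔸)‖ ≤ ρ))
    (hl : ‖lam x‖ ≤ B) (hB : ∀ μ, ‖lam (T μ x)‖ ≤ B ∧ ‖lam ((T μ).symm x)‖ ≤ B) :
    ‖V0op T U η A lam x‖ ≤ (2 + 8 * ρ ^ 2 * α₁) * Fintype.card κ * α₁ * (s ^ 2)⁻¹ * B := by
  have hB0 : 0 ≤ B := (norm_nonneg _).trans hl
  have ha : 0 ≤ α₁ * s⁻¹ := mul_nonneg hα (inv_nonneg.mpr hs.le)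
  -- the divergence: a sum of `d` starred differences
  have hdiv : ‖((η : ℂ)⁻¹) • divB T U A x‖ ≤ Fintype.card κ * (α₁ * (s ^ 2)⁻¹) := by
    rw [divB, Finset.smul_sum]
    refine (norm_sum_le _ _).trans ?_
    calc ∑ μ, ‖((η : ℂ)⁻¹) • covDstar T U μ (A μ) x‖ ≤ ∑ _μ : κ, α₁ * (s ^ 2)⁻¹ :=
          Finset.sum_le_sum fun μ _ => h337s μ
      _ = Fintype.card κ * (α₁ * (s ^ 2)⁻¹) := by rw [Finset.sum_const, Finset.card_univ, nsmul_eq_mul]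
  have h := norm_V0op_le T U hη A lam x hA hdiv hρ hl hB
  have he : Real.exp (2 * (η * (α₁ * s⁻¹))) ≤ 2 := exp_two_mul_le_two hsmall
  have hd : (0 : ℝ) ≤ Fintype.card κ := Nat.cast_nonneg _
  have hsq : (α₁ * s⁻¹) ^ 2 = α₁ ^ 2 * (s ^ 2)⁻¹ := by rw [mul_pow, inv_pow]
  calc ‖V0op T U η A lam x‖
      ≤ (2 * (Fintype.card κ * (α₁ * (s ^ 2)⁻¹))
          + 4 * Fintype.card κ * ρ ^ 2 * ((α₁ * s⁻¹) ^ 2 * Real.exp (2 * (η * (α₁ * s⁻¹))))) * B := h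
    _ ≤ (2 * (Fintype.card κ * (α₁ * (s ^ 2)⁻¹)) + 4 * Fintype.card κ * ρ ^ 2 * ((α₁ * s⁻¹) ^ 2 * 2)) * B := by
          have h4 : 0 ≤ 4 * Fintype.card κ * ρ ^ 2 * (α₁ * s⁻¹) ^ 2 := by positivity
          have := mul_le_mul_of_nonneg_left he h4
          apply mul_le_mul_of_nonneg_right _ hB0
          nlinarith
    _ = (2 + 8 * ρ ^ 2 * α₁) * Fintype.card κ * α₁ * (s ^ 2)⁻¹ * B := by rw [hsq]; ring

/-- **`hV0` FOR THE CONCRETE `V⁰` of `V′₁(A)`** in the block-majorant calculus: under (3.37) read blockwise for the letters as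
they occur (`ℓ = g.len y`, `y` the block of `x`), `ηα₁ℓ⁻¹ ≦ 1/4`, transports of size `≦ ρ`, the star of every `x` in blocks at
`d`-distance `≦ d₀` of its block and `d(y,y) ≦ d₀`:
`conj b (V0op η A) ≺ c_C·α₁·ℓ⁻²·e^{−δd(y,y′)}`, `c_C = (2 + 8ρ²α₁)·d·M₂(Σ_i‖b_i‖)·e^{δd₀}` — the hypothesis `hV0` of the
finite-sum device, the size `|V⁰| ≦ O(1)α₁(Lʲη)⁻²` of the gradient-form reading of (3.73) (module header; a reading, not a
quotation) for the operator of (3.52).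
[cite: Balaban1985BackgroundPropagators, (3.73) p.405 + (3.52) p.400 + (3.54) p.401 + (3.37) p.396; Balaban1984PropagatorsII, (2.51) p.232] -/
theorem hasMajorant_V0op (blk : S → g.Site) {η : ℝ} (hη : 0 < η) (A : κ → S → 𝔸) (ρ d₀ δ M₂ α₁ : ℝ)
    (hα₁ : 0 ≤ α₁) (hδ : 0 ≤ δ) (hM₂ : 0 ≤ M₂) (hrepr : ∀ (v : 𝔸) (i : ι), |b.repr v i| ≤ M₂ * ‖v‖)
    (hlen : ∀ y : g.Site, 0 < g.len y) (hsmall : ∀ y : g.Site, η * (α₁ * (g.len y)⁻¹) ≤ 1 / 4)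
    (hA : ∀ μ x, ‖A μ x‖ ≤ α₁ * (g.len (blk x))⁻¹ ∧ ‖tauB T U μ (A μ) x‖ ≤ α₁ * (g.len (blk x))⁻¹)
    (h337s : ∀ μ x, ‖((η : ℂ)⁻¹) • covDstar T U μ (A μ) x‖ ≤ α₁ * (g.len (blk x) ^ 2)⁻¹)
    (hρ : ∀ μ x, ‖((U μ x : 𝔸ˣ) : 𝔸)‖ ≤ ρ ∧ ‖(((U μ x)⁻¹ : 𝔸ˣ) : 𝔸)‖ ≤ ρ)
    (hd₀ : ∀ μ x, g.dist (blk x) (blk (T μ x)) ≤ d₀ ∧ g.dist (blk x) (blk ((T μ).symm x)) ≤ d₀)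
    (hd₀0 : ∀ y : g.Site, g.dist y y ≤ d₀) :
    HasMajorant (g := toB6 g Rr H) (fun p : S × ι => blk p.1) (conj b (V0op T U η A))
      (fun y y' => ((2 + 8 * ρ ^ 2 * α₁) * Fintype.card κ * M₂ * (∑ i, ‖b i‖) * Real.exp (δ * d₀)) * α₁ *
        (g.len y ^ 2)⁻¹ * Real.exp (-(δ * g.dist y y'))) := by
  have hd : (0 : ℝ) ≤ Fintype.card κ := Nat.cast_nonneg _
  have hc0 : ∀ y : g.Site, 0 ≤ (2 + 8 * ρ ^ 2 * α₁) * Fintype.card κ * α₁ * (g.len y ^ 2)⁻¹ := fun y => by positivity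
  refine hasMajorant_mono (g := toB6 g Rr H) _
    (hasMajorant_conj_of_local (Rr := Rr) (H := H) b blk (fun x x' => x' = x ∨ ∃ μ, x' = T μ x ∨ x' = (T μ).symm x)
      (fun y => (2 + 8 * ρ ^ 2 * α₁) * Fintype.card κ * α₁ * (g.len y ^ 2)⁻¹) d₀ δ M₂ hc0 hδ hM₂ hrepr ?_
      (V0op T U η A) ?_) fun y y' => le_of_eq ?_
  · rintro x x' (rfl | ⟨μ, rfl | rfl⟩)
    · exact hd₀0 _
    · exact (hd₀ μ x).1
    · exact (hd₀ μ x).2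
  · intro f x B hB
    exact norm_V0op_le_printed T U hη A f x hα₁ (hlen _) (hsmall _) (fun μ => hA μ x) (fun μ => h337s μ x)
      (fun μ => ⟨hρ μ x, hρ μ ((T μ).symm x)⟩) (hB x (Or.inl rfl))
      (fun μ => ⟨hB _ (Or.inr ⟨μ, Or.inl rfl⟩), hB _ (Or.inr ⟨μ, Or.inr rfl⟩)⟩)
  · ring

/-- **THE ZEROTH-ORDER OPERATOR OF THE DIVERGENCE FORM OF `V′₁(A)` ON THE CONCRETE CARRIER**: `C″₁(A) := V⁰ + Σ_k [V¹_k, ∇_k]`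
(the operator by which `V′₁ = Σ_k ∇_kV¹_k + C″₁`, `conj_V1pOp_eq_divForm`) satisfies `conj b C″₁ ≺ c·α₁·(Lʲη)⁻²·e^{−δd}`,
`c = ((2 + 8ρ²α₁)·d + 4dρ²)·M₂(Σ_i‖b_i‖)e^{δd₀}` — the divergence-form reading of (3.52)–(3.54) (the size `|V⁰| ≦
O(1)α₁(Lʲη)⁻²` of the gradient-form reading of (3.73), module header, with the commutators `[V¹,∇]` of the lattice
Leibniz rule [B8] (1.87) of the same size by (3.37)) as a theorem about
the concrete lattice operators (`B9Ineq386CommSum.hasMajorant_C₃_of_comm_sum` fed with `hasMajorant_V0op` and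
`hasMajorant_comm_coefLetter_diffLetter`).
[cite: Balaban1985BackgroundPropagators, (3.52) p.400 + (3.54) p.401 + (3.73) p.405 + (3.37) p.396; Balaban1985RegularSpaces, (1.87) p.91; Balaban1984PropagatorsII, (2.51)–(2.52) p.232] -/
theorem hasMajorant_divForm_zeroth_V1pOp (blk : S → g.Site) {η : ℝ} (hη : 0 < η) (A : κ → S → 𝔸) (ρ d₀ δ M₂ α₁ : ℝ)
    (hα₁ : 0 ≤ α₁) (hδ : 0 ≤ δ) (hM₂ : 0 ≤ M₂) (hrepr : ∀ (v : 𝔸) (i : ι), |b.repr v i| ≤ M₂ * ‖v‖)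
    (hlen : ∀ y : g.Site, 0 < g.len y) (hsmall : ∀ y : g.Site, η * (α₁ * (g.len y)⁻¹) ≤ 1 / 4)
    (hA : ∀ μ x, ‖A μ x‖ ≤ α₁ * (g.len (blk x))⁻¹ ∧ ‖tauB T U μ (A μ) x‖ ≤ α₁ * (g.len (blk x))⁻¹)
    (h337s : ∀ μ x, ‖((η : ℂ)⁻¹) • covDstar T U μ (A μ) x‖ ≤ α₁ * (g.len (blk x) ^ 2)⁻¹)
    (h337F : ∀ μ x, ‖((η : ℂ)⁻¹) • covD T U μ (A μ) x‖ ≤ α₁ * (g.len (blk x) ^ 2)⁻¹)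
    (h337B : ∀ μ x, ‖((η : ℂ)⁻¹) • covDstar T U μ (tauB T U μ (A μ)) x‖ ≤ α₁ * (g.len (blk x) ^ 2)⁻¹)
    (hρ : ∀ μ x, ‖((U μ x : 𝔸ˣ) : 𝔸)‖ ≤ ρ ∧ ‖(((U μ x)⁻¹ : 𝔸ˣ) : 𝔸)‖ ≤ ρ)
    (hd₀ : ∀ μ x, g.dist (blk x) (blk (T μ x)) ≤ d₀ ∧ g.dist (blk x) (blk ((T μ).symm x)) ≤ d₀)
    (hd₀0 : ∀ y : g.Site, g.dist y y ≤ d₀) :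
    HasMajorant (g := toB6 g Rr H) (fun p : S × ι => blk p.1)
      (conj b (V0op T U η A)
        + ∑ k ∈ Finset.univ, (conj b (coefLetter T U A k) * conj b (diffLetter T U ((η : ℂ)⁻¹) k)
            - conj b (diffLetter T U ((η : ℂ)⁻¹) k) * conj b (coefLetter T U A k)))
      (fun y y' => (((2 + 8 * ρ ^ 2 * α₁) * Fintype.card κ + 4 * Fintype.card κ * ρ ^ 2)
          * M₂ * (∑ i, ‖b i‖) * Real.exp (δ * d₀)) * α₁ * (g.len y ^ 2)⁻¹ * Real.exp (-(δ * g.dist y y'))) := by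
  have h := hasMajorant_C₃_of_comm_sum (R := Rr) (H := H) (fun p : S × ι => blk p.1) (Finset.univ : Finset (κ ⊕ κ)) δ
    ((2 + 8 * ρ ^ 2 * α₁) * Fintype.card κ * M₂ * (∑ i, ‖b i‖) * Real.exp (δ * d₀)) α₁
    (fun _ => 2 * ρ ^ 2 * M₂ * (∑ i, ‖b i‖) * Real.exp (δ * d₀))
    (V1 := fun k => conj b (coefLetter T U A k)) (D := fun k => conj b (diffLetter T U ((η : ℂ)⁻¹) k))
    (hasMajorant_V0op b T U blk hη A ρ d₀ δ M₂ α₁ hα₁ hδ hM₂ hrepr hlen hsmall hA h337s hρ hd₀ hd₀0)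
    (fun k _ => hasMajorant_comm_coefLetter_diffLetter b T U blk η A ρ d₀ δ M₂ α₁ hα₁ hδ hM₂ hrepr h337F h337B hρ hd₀ k)
  refine hasMajorant_mono (g := toB6 g Rr H) _ h fun y y' => le_of_eq ?_
  rw [Finset.sum_const, Finset.card_univ, Fintype.card_sum, nsmul_eq_mul, Nat.cast_add]
  ring

end Sizes

end Literature.MathematicalPhysics.QuantumFieldTheory.Balaban1983to89.B9Eq352GradLetters
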